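import Summits.NavierStokesRegularity.FluidComputer.GateBudgetCarrierPhase
import HarnessLib

/-!
# What no tuning can beat, part 16: THE EXIT PHASE IS PINNED — armed-at-entry and dead-at-exit
# clock LEVELS force the arctan swing `≈ π`, hence the dose phase `Φ ≈ π/(σ_knob M)` on EVERY
# member, and on the lattice `σ_knob M = 1/k` the carrier leaves the pulse in PURE INPUT PHASE

Cell `pub-fluidc`, blueprint seat bp1 (gen 29); same namespace and conventions as parts 1–15
(`GateBudget*.lean`); imports part 14 (`GateBudgetCarrierPhase`: the phase-tracking laws
`knob_phase_tracking_d/_a` and the dose phase `knob_dose_phase`). Modes `0 = a` input, `1 = b`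
clock, `2 = c` catalyst (`u = c/ρ²`), `3 = d` transfer, `4 = ã` output; `σ_knob = ρ²/ε`.
HONEST FRAMING (verbatim): low prior, high value-of-information experiment on Tao's machine
paradigm; NOT a claim that NS blows up. Nothing is proved about the Navier–Stokes equations.

## What this part records (SPEC-INPUT-bp1 §W item (1) = S13″c (iii), phase half: UNIFORM PHASE
## DOUBLING — the swing of the clock pair is a half turn up to LEVEL losses, on every member)

Everything is about ONE exact trajectory of ONE member `rotorCircuit K M ε ρ` started at (5.6)
(`0 < ε`, `0 < ρ`, `0 < M`, `0 ≤ K`), a primitive `C` of the catalyst (`C' = c`, part 14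
`exists_catalyst_primitive`), an ENTRY time `s₀ ≥ 0` and a CLOCK-DEATH time `T ≥ s₀`;
`Φ := (C T - C s₀)/ρ²` is the dose phase of the pulse, `Φ₀ := (C s₀ - C 0)/ρ²` the pre-entry
dose, `Θ := Φ₀ + Φ = (C T - C 0)/ρ²` the total phase; `L_t := ε + ρ²e^{-M} + Kã(t)`.
* §49 THE SWING FROM LEVELS (`arctan_div_ge_of_armed`, `arctan_div_le_of_dead`,
  `knob_swing_lower`, `swing_lt_pi`): ARMED at entry (`b(s₀) ≥ b₁ > 0`, `0 < c(s₀) ≤ γ₁`) and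
  DEAD at exit (`b(T) ≤ -β < 0`, `0 < c(T) ≤ λ₀ρ²`) force the arctan swing of parts 6/14,
  `Δ := arctan(b/c)(s₀) - arctan(b/c)(T)`, into `[π - η, π)`,
  `η := arctan(γ₁/b₁) + arctan(λ₀ρ²/β)`: the clock pair makes (almost exactly) HALF A TURN.
* §50 THE PHASE BRACKET (`knob_phase_bracket`): given any swing bound `Δ ≥ π - η` and part 14's
  window on `[s₀,T]` (catalyst alive, clock pair of radius `≥ ϱ`, `Mϱ² > ε²`):
  `(ε/(Mρ²))·(π - η - D₀) ≤ Φ ≤ (ε/(Mρ²))·(π + D₀)/(1 - q)`, `D₀ := ρ²e^{-M}(T - s₀)/ϱ`,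
  `q := ε²/(Mϱ²)` — `Φ ≈ π/(σ_knob M)` on EVERY member: halving the knob DOUBLES the exit phase,
  with constants that do not depend on the member beyond `λ₀ρ²` and `D₀` (both monotone in `ρ`).
* §51 TRACKING FROM THE START (`knob_entry_tracking`, `knob_total_tracking`): (5.6) is the pure
  input state `(a,d) = (1,0)`, so `|d(T) - sin Θ| ≤ D` and `|a(T) - cos Θ| ≤ D`,
  `D := 4L_{s₀}s₀ + 2L_T(T - s₀)`; PINNED EXIT (`knob_pinned_exit`): `|Θ - kπ| ≤ ψ` (`k ∈ ℕ`)
  ⇒ `|d(T)| ≤ ψ + D` and `|a(T)| ≥ 1 - ψ²/2 - D`; THE LATTICE (`knob_lattice_phase`): on the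
  member `ε = kMρ²` (`σ_knob M = 1/k`), `|Θ - kπ| ≤ k(η + (πq + D₀)/(1 - q)) + φ₀` whenever
  `|Φ₀| ≤ φ₀` — the carrier leaves the pulse turned by `k` half turns: in PURE INPUT PHASE
  (nothing transferred up to `ψ + D`). Part 17 (`GateBudgetDudLattice`) turns this into duds.

HONEST LIMITS. The clock/catalyst LEVELS at the common times `s₀`, `T` (armed / dead, window
radius `ϱ`, `u(T) ≤ λ₀`) and the pre-entry dose bound `|Φ₀| ≤ φ₀` are HYPOTHESES (no hitting
times are constructed; bounding `Φ₀` by catalyst levels before entry is a successor item); the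
drift `D` is part 14's and carries the output `ã(T)` (content only for `Kã(T)(T - s₀) ≲ 1`);
nothing about the cascade or Navier–Stokes; `0` named facts, `0` sorry.
[cite: Tao2016AveragedNS, §5.5 Theorem 5.3, (5.5), (5.6), (b-eq), (energy-con)]
-/

noncomputable section

namespace Summit.NavierStokesRegularity.FluidComputer.GateBudget

open Real Set Filter Topology
open Literature.Analysis.FluidPDE.Tao2016AveragedNS

variable {K M ε ρ : ℝ} {X : ℝ → Fin 5 → ℝ} {C : ℝ → ℝ}

/-! ## §49 The swing from levels: armed at entry, dead at exit ⇒ half a turn of the clock pair -/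

/-- **ARMED LEVEL.** `0 < b₁ ≤ b` and `0 < c ≤ γ` ⇒ `arctan(b/c) ≥ π/2 - arctan(γ/b₁)`.
[folklore] -/
theorem arctan_div_ge_of_armed {b c b₁ γ : ℝ} (hb₁ : 0 < b₁) (hb : b₁ ≤ b) (hc : 0 < c)
    (hcγ : c ≤ γ) : π / 2 - arctan (γ / b₁) ≤ arctan (b / c) := by
  have hγ : 0 < γ := hc.trans_le hcγ
  have h1 : b₁ / γ ≤ b / c := by
    rw [le_div_iff₀ hc]
    calc b₁ / γ * c ≤ b₁ / γ * γ := mul_le_mul_of_nonneg_left hcγ (div_pos hb₁ hγ).le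
      _ = b₁ := div_mul_cancel₀ b₁ hγ.ne'
      _ ≤ b := hb
  have h2 : arctan (b₁ / γ) = π / 2 - arctan (γ / b₁) := by
    have h := arctan_inv_of_pos (div_pos hγ hb₁)
    rwa [inv_div] at h
  rw [← h2]
  exact arctan_mono h1

/-- **DEAD LEVEL.** `b ≤ -β < 0` and `0 < c ≤ λ` ⇒ `arctan(b/c) ≤ -π/2 + arctan(λ/β)`.
[folklore] -/
theorem arctan_div_le_of_dead {b c β lam : ℝ} (hβ : 0 < β) (hb : b ≤ -β) (hc : 0 < c)
    (hcl : c ≤ lam) : arctan (b / c) ≤ -(π / 2) + arctan (lam / β) := by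
  have hl : 0 < lam := hc.trans_le hcl
  have h1 : b / c ≤ -(β / lam) := by
    rw [div_le_iff₀ hc]
    have h : β / lam * c ≤ β := by
      calc β / lam * c ≤ β / lam * lam := mul_le_mul_of_nonneg_left hcl (div_pos hβ hl).le
        _ = β := div_mul_cancel₀ β hl.ne'
    linarith
  have h2 : arctan (β / lam) = π / 2 - arctan (lam / β) := by
    have h := arctan_inv_of_pos (div_pos hl hβ)
    rwa [inv_div] at h
  have h3 : arctan (b / c) ≤ arctan (-(β / lam)) := arctan_mono h1
  rw [arctan_neg, h2] at h3
  linarith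

/-- The arctan swing is always `< π`. [folklore] -/
theorem swing_lt_pi (x y : ℝ) : arctan x - arctan y < π := by
  linarith [arctan_lt_pi_div_two x, neg_pi_div_two_lt_arctan y]

/-- **THE SWING FROM LEVELS, knob family.** ARMED at `s₀` (`b(s₀) ≥ b₁ > 0`, `0 < c(s₀) ≤ γ₁`)
and DEAD at `T` (`b(T) ≤ -β < 0`, `0 < c(T) ≤ λ₀ρ²`) ⇒
`π - arctan(γ₁/b₁) - arctan(λ₀ρ²/β) ≤ arctan(b(s₀)/c(s₀)) - arctan(b(T)/c(T))`: the swing of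
part 6's dose law is a half turn up to the level losses. [cite: Tao2016AveragedNS, §5.5 (b-eq)] -/
theorem knob_swing_lower {s₀ T b₁ γ₁ β lam₀ : ℝ} (hb₁ : 0 < b₁) (hbs : b₁ ≤ X s₀ 1)
    (hcs : 0 < X s₀ 2) (hcγ : X s₀ 2 ≤ γ₁) (hβ : 0 < β) (hbT : X T 1 ≤ -β) (hcT : 0 < X T 2)
    (hcl : X T 2 ≤ lam₀ * ρ ^ 2) :
    π - (arctan (γ₁ / b₁) + arctan (lam₀ * ρ ^ 2 / β))
      ≤ arctan (X s₀ 1 / X s₀ 2) - arctan (X T 1 / X T 2) := by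
  have h1 := arctan_div_ge_of_armed hb₁ hbs hcs hcγ
  have h2 := arctan_div_le_of_dead hβ hbT hcT hcl
  linarith

/-! ## §50 The phase bracket: `Φ ≈ π/(σ_knob M)` on every member -/

/-- **THE PHASE BRACKET.** Along `rotorCircuit K M ε ρ` (`0 < ε`, `0 < ρ`, `0 < M`) with a
catalyst primitive `C`, on a window `[s₀,T]` with the catalyst alive, clock pair of radius
`≥ ϱ > 0`, `Mϱ² > ε²`, and swing `≥ π - η`:
`(ε/(Mρ²))(π - η - D₀) ≤ Φ` and `Φ ≤ (ε/(Mρ²))(π + D₀)/(1 - ε²/(Mϱ²))`,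
`Φ = (C T - C s₀)/ρ²`, `D₀ = ρ²e^{-M}(T-s₀)/ϱ` (part 14 `knob_dose_phase`, `Δ < π`).
[cite: Tao2016AveragedNS, §5.5 Theorem 5.3, (5.5), (b-eq)] -/
theorem knob_phase_bracket (hX : ∀ t, HasDerivAt X (RotorKnob.rotorCircuit K M ε ρ (X t)) t)
    (h0 : X 0 = delayInit) (hε : 0 < ε) (hρ : 0 < ρ) (hM : 0 < M)
    (hC : ∀ t, HasDerivAt C (X t 2) t) {s₀ T ϱ η : ℝ} (hsT : s₀ ≤ T) (hϱ : 0 < ϱ)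
    (hq : ε ^ 2 < M * ϱ ^ 2) (hc : ∀ t ∈ Icc s₀ T, 0 < X t 2)
    (hr : ∀ t ∈ Icc s₀ T, ϱ ^ 2 ≤ X t 1 ^ 2 + X t 2 ^ 2)
    (hη : π - η ≤ arctan (X s₀ 1 / X s₀ 2) - arctan (X T 1 / X T 2)) :
    ε / (M * ρ ^ 2) * (π - η - ρ ^ 2 * exp (-M) * (T - s₀) / ϱ) ≤ (C T - C s₀) / ρ ^ 2 ∧
      (C T - C s₀) / ρ ^ 2 ≤ ε / (M * ρ ^ 2) * (π + ρ ^ 2 * exp (-M) * (T - s₀) / ϱ)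
        / (1 - ε ^ 2 / (M * ϱ ^ 2)) := by
  obtain ⟨h1, h2⟩ := knob_dose_phase hX h0 hε hρ hC hsT hϱ hc hr
  have hπ := swing_lt_pi (X s₀ 1 / X s₀ 2) (X T 1 / X T 2)
  have hκ : 0 < ε / (M * ρ ^ 2) := by positivity
  have hρ2 : (ρ ^ 2 : ℝ) ≠ 0 := by positivity
  have hεne : ε ≠ 0 := hε.ne'
  have hMne : M ≠ 0 := hM.ne'
  have hϱne : ϱ ≠ 0 := hϱ.ne'
  constructor
  · have hid : ε / (M * ρ ^ 2) * (ε⁻¹ * M * (ρ ^ 2 * ((C T - C s₀) / ρ ^ 2)))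
        = (C T - C s₀) / ρ ^ 2 := by
      field_simp
    calc ε / (M * ρ ^ 2) * (π - η - ρ ^ 2 * exp (-M) * (T - s₀) / ϱ)
        ≤ ε / (M * ρ ^ 2) * (ε⁻¹ * M * (ρ ^ 2 * ((C T - C s₀) / ρ ^ 2))) :=
          mul_le_mul_of_nonneg_left (by linarith) hκ.le
      _ = (C T - C s₀) / ρ ^ 2 := hid
  · have h1q : 0 < 1 - ε ^ 2 / (M * ϱ ^ 2) :=
      sub_pos.2 ((div_lt_one (by positivity)).2 hq)
    rw [le_div_iff₀ h1q]
    have hid : (C T - C s₀) / ρ ^ 2 * (1 - ε ^ 2 / (M * ϱ ^ 2))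
        = ε / (M * ρ ^ 2) * ((ε⁻¹ * M - ε / ϱ ^ 2) * (ρ ^ 2 * ((C T - C s₀) / ρ ^ 2))) := by
      field_simp
    rw [hid]
    exact mul_le_mul_of_nonneg_left (by linarith) hκ.le

/-! ## §51 Tracking from the start, the pinned exit, and the lattice -/

/-- **ENTRY TRACKING.** (5.6) is the pure input state, so at any `s₀ ≥ 0`:
`|d(s₀) - sin Φ₀| ≤ 2L_{s₀}s₀` and `|a(s₀) - cos Φ₀| ≤ 2L_{s₀}s₀`, `Φ₀ = (C s₀ - C 0)/ρ²`
(part 14's tracking laws on `[0, s₀]`). [cite: Tao2016AveragedNS, §5.5 Theorem 5.3, (5.6)] -/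
theorem knob_entry_tracking (hX : ∀ t, HasDerivAt X (RotorKnob.rotorCircuit K M ε ρ (X t)) t)
    (h0 : X 0 = delayInit) (hC : ∀ t, HasDerivAt C (X t 2) t) (hε : 0 ≤ ε) (hK : 0 ≤ K)
    {s₀ : ℝ} (hs₀ : 0 ≤ s₀) :
    |X s₀ 3 - sin ((C s₀ - C 0) / ρ ^ 2)| ≤ 2 * ((ε + ρ ^ 2 * exp (-M) + K * X s₀ 4) * s₀) ∧
      |X s₀ 0 - cos ((C s₀ - C 0) / ρ ^ 2)|
        ≤ 2 * ((ε + ρ ^ 2 * exp (-M) + K * X s₀ 4) * s₀) := by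
  have ha0 : X 0 0 = 1 := by rw [h0]; rfl
  have hd0 : X 0 3 = 0 := by rw [h0]; rfl
  have hd := knob_phase_tracking_d hX h0 hC hε hK le_rfl hs₀
  have ha := knob_phase_tracking_a hX h0 hC hε hK le_rfl hs₀
  rw [ha0, hd0] at hd ha
  simp only [mul_one, mul_zero, add_zero, sub_zero] at hd ha
  exact ⟨hd, ha⟩

/-- **TOTAL TRACKING.** For `0 ≤ s₀ ≤ T` and the total phase `Θ = (C T - C 0)/ρ²`:
`|d(T) - sin Θ| ≤ D` and `|a(T) - cos Θ| ≤ D`, `D = 4L_{s₀}s₀ + 2L_T(T - s₀)`: the carrier at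
clock death is the UNIT INPUT turned by the total dose phase (tracking on `[0,s₀]` and `[s₀,T]`
composed through the angle-addition formulas). [cite: Tao2016AveragedNS, §5.5 Theorem 5.3, (5.5)] -/
theorem knob_total_tracking (hX : ∀ t, HasDerivAt X (RotorKnob.rotorCircuit K M ε ρ (X t)) t)
    (h0 : X 0 = delayInit) (hC : ∀ t, HasDerivAt C (X t 2) t) (hε : 0 ≤ ε) (hK : 0 ≤ K)
    {s₀ T : ℝ} (hs₀ : 0 ≤ s₀) (hsT : s₀ ≤ T) :
    |X T 3 - sin ((C T - C 0) / ρ ^ 2)| ≤ 4 * ((ε + ρ ^ 2 * exp (-M) + K * X s₀ 4) * s₀)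
        + 2 * ((ε + ρ ^ 2 * exp (-M) + K * X T 4) * (T - s₀)) ∧
      |X T 0 - cos ((C T - C 0) / ρ ^ 2)| ≤ 4 * ((ε + ρ ^ 2 * exp (-M) + K * X s₀ 4) * s₀)
        + 2 * ((ε + ρ ^ 2 * exp (-M) + K * X T 4) * (T - s₀)) := by
  obtain ⟨ed, ea⟩ := knob_entry_tracking hX h0 hC hε hK hs₀
  have td := knob_phase_tracking_d hX h0 hC hε hK hs₀ hsT
  have ta := knob_phase_tracking_a hX h0 hC hε hK hs₀ hsT
  set Φ := (C T - C s₀) / ρ ^ 2 with hΦ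
  set Φ₀ := (C s₀ - C 0) / ρ ^ 2 with hΦ₀
  have hsplit : (C T - C 0) / ρ ^ 2 = Φ + Φ₀ := by rw [hΦ, hΦ₀]; ring
  have hs1 : |sin Φ * (X s₀ 0 - cos Φ₀)| ≤ 2 * ((ε + ρ ^ 2 * exp (-M) + K * X s₀ 4) * s₀) := by
    rw [abs_mul]; exact (mul_le_mul (abs_sin_le_one Φ) ea (abs_nonneg _) zero_le_one).trans_eq
      (one_mul _)
  have hs2 : |cos Φ * (X s₀ 3 - sin Φ₀)| ≤ 2 * ((ε + ρ ^ 2 * exp (-M) + K * X s₀ 4) * s₀) := by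
    rw [abs_mul]; exact (mul_le_mul (abs_cos_le_one Φ) ed (abs_nonneg _) zero_le_one).trans_eq
      (one_mul _)
  have hs3 : |cos Φ * (X s₀ 0 - cos Φ₀)| ≤ 2 * ((ε + ρ ^ 2 * exp (-M) + K * X s₀ 4) * s₀) := by
    rw [abs_mul]; exact (mul_le_mul (abs_cos_le_one Φ) ea (abs_nonneg _) zero_le_one).trans_eq
      (one_mul _)
  have hs4 : |sin Φ * (X s₀ 3 - sin Φ₀)| ≤ 2 * ((ε + ρ ^ 2 * exp (-M) + K * X s₀ 4) * s₀) := by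
    rw [abs_mul]; exact (mul_le_mul (abs_sin_le_one Φ) ed (abs_nonneg _) zero_le_one).trans_eq
      (one_mul _)
  rw [hsplit, sin_add, cos_add]
  constructor
  · have hid : X T 3 - (sin Φ * cos Φ₀ + cos Φ * sin Φ₀)
        = X T 3 - (sin Φ * X s₀ 0 + cos Φ * X s₀ 3) + sin Φ * (X s₀ 0 - cos Φ₀)
          + cos Φ * (X s₀ 3 - sin Φ₀) := by ring
    rw [hid]
    linarith [abs_add_three (X T 3 - (sin Φ * X s₀ 0 + cos Φ * X s₀ 3))
      (sin Φ * (X s₀ 0 - cos Φ₀)) (cos Φ * (X s₀ 3 - sin Φ₀))]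
  · have hid : X T 0 - (cos Φ * cos Φ₀ - sin Φ * sin Φ₀)
        = X T 0 - (cos Φ * X s₀ 0 - sin Φ * X s₀ 3) + cos Φ * (X s₀ 0 - cos Φ₀)
          + -(sin Φ * (X s₀ 3 - sin Φ₀)) := by ring
    rw [hid]
    have hn : |-(sin Φ * (X s₀ 3 - sin Φ₀))| = |sin Φ * (X s₀ 3 - sin Φ₀)| := abs_neg _
    linarith [abs_add_three (X T 0 - (cos Φ * X s₀ 0 - sin Φ * X s₀ 3))
      (cos Φ * (X s₀ 0 - cos Φ₀)) (-(sin Φ * (X s₀ 3 - sin Φ₀)))]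

/-- **PINNED EXIT.** If the total phase is within `ψ` of a multiple of `π`, `|Θ - kπ| ≤ ψ`, then
`|d(T)| ≤ ψ + D` and `1 - ψ²/2 - D ≤ |a(T)|`: the carrier leaves in (nearly) PURE INPUT PHASE
(`|sin x| ≤ |x|`, `cos x ≥ 1 - x²/2` about `kπ`).
[cite: Tao2016AveragedNS, §5.5 Theorem 5.3, (5.5)] -/
theorem knob_pinned_exit (hX : ∀ t, HasDerivAt X (RotorKnob.rotorCircuit K M ε ρ (X t)) t)
    (h0 : X 0 = delayInit) (hC : ∀ t, HasDerivAt C (X t 2) t) (hε : 0 ≤ ε) (hK : 0 ≤ K)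
    {s₀ T : ℝ} (hs₀ : 0 ≤ s₀) (hsT : s₀ ≤ T) (k : ℕ) {ψ : ℝ}
    (hψ : |(C T - C 0) / ρ ^ 2 - k * π| ≤ ψ) :
    |X T 3| ≤ ψ + (4 * ((ε + ρ ^ 2 * exp (-M) + K * X s₀ 4) * s₀)
        + 2 * ((ε + ρ ^ 2 * exp (-M) + K * X T 4) * (T - s₀))) ∧
      1 - ψ ^ 2 / 2 - (4 * ((ε + ρ ^ 2 * exp (-M) + K * X s₀ 4) * s₀)
        + 2 * ((ε + ρ ^ 2 * exp (-M) + K * X T 4) * (T - s₀))) ≤ |X T 0| := by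
  obtain ⟨td, ta⟩ := knob_total_tracking hX h0 hC hε hK hs₀ hsT
  set θ := (C T - C 0) / ρ ^ 2 - k * π with hθ
  have hΘ : (C T - C 0) / ρ ^ 2 = θ + k * π := by rw [hθ]; ring
  rw [hΘ, sin_add_nat_mul_pi] at td
  rw [hΘ, cos_add_nat_mul_pi] at ta
  have hu : |((-1 : ℝ) ^ k)| = 1 := by rw [abs_pow, abs_neg, abs_one, one_pow]
  have hsin : |(-1 : ℝ) ^ k * sin θ| ≤ ψ := by
    rw [abs_mul, hu, one_mul]; exact abs_sin_le_abs.trans hψ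
  have hθ2 : θ ^ 2 ≤ ψ ^ 2 := by
    have h := abs_le.1 hψ
    nlinarith [abs_nonneg θ, hψ, sq_abs θ]
  have hcos : 1 - ψ ^ 2 / 2 ≤ |(-1 : ℝ) ^ k * cos θ| := by
    rw [abs_mul, hu, one_mul]
    exact le_trans (by linarith [one_sub_sq_div_two_le_cos (x := θ)]) (le_abs_self (cos θ))
  constructor
  · have h := abs_sub_abs_le_abs_sub (X T 3) ((-1 : ℝ) ^ k * sin θ)
    linarith
  · have h := abs_sub_abs_le_abs_sub ((-1 : ℝ) ^ k * cos θ) (X T 0)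
    rw [abs_sub_comm] at h
    linarith

/-- **THE LATTICE PHASE.** On the lattice member `ε = kMρ²` (`σ_knob M = 1/k`), with the window
of `knob_phase_bracket`, swing `≥ π - η` and pre-entry dose `|Φ₀| ≤ φ₀`:
`|Θ - kπ| ≤ k(η + (π ε²/(Mϱ²) + D₀)/(1 - ε²/(Mϱ²))) + φ₀` — the total phase at clock death is
`k` half turns up to the level losses. [cite: Tao2016AveragedNS, §5.5 Theorem 5.3, (5.5), (b-eq)] -/
theorem knob_lattice_phase (hX : ∀ t, HasDerivAt X (RotorKnob.rotorCircuit K M ε ρ (X t)) t)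
    (h0 : X 0 = delayInit) (hε : 0 < ε) (hρ : 0 < ρ) (hM : 0 < M)
    (hC : ∀ t, HasDerivAt C (X t 2) t) (k : ℕ) (hk : ε = k * M * ρ ^ 2) {s₀ T ϱ η φ₀ : ℝ}
    (hsT : s₀ ≤ T) (hϱ : 0 < ϱ) (hq : ε ^ 2 < M * ϱ ^ 2) (hc : ∀ t ∈ Icc s₀ T, 0 < X t 2)
    (hr : ∀ t ∈ Icc s₀ T, ϱ ^ 2 ≤ X t 1 ^ 2 + X t 2 ^ 2)
    (hη : π - η ≤ arctan (X s₀ 1 / X s₀ 2) - arctan (X T 1 / X T 2))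
    (hΦ₀ : |(C s₀ - C 0) / ρ ^ 2| ≤ φ₀) :
    |(C T - C 0) / ρ ^ 2 - k * π| ≤ k * (η + (π * (ε ^ 2 / (M * ϱ ^ 2))
        + ρ ^ 2 * exp (-M) * (T - s₀) / ϱ) / (1 - ε ^ 2 / (M * ϱ ^ 2))) + φ₀ := by
  obtain ⟨hlo, hhi⟩ := knob_phase_bracket hX h0 hε hρ hM hC hsT hϱ hq hc hr hη
  have hκ : ε / (M * ρ ^ 2) = k := by
    rw [div_eq_iff (by positivity), hk]; ring
  rw [hκ] at hlo hhi
  have h1q : 0 < 1 - ε ^ 2 / (M * ϱ ^ 2) := sub_pos.2 ((div_lt_one (by positivity)).2 hq)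
  have hq0 : 0 ≤ ε ^ 2 / (M * ϱ ^ 2) := by positivity
  have hD0 : 0 ≤ ρ ^ 2 * exp (-M) * (T - s₀) / ϱ := by
    have : 0 ≤ T - s₀ := by linarith
    positivity
  have hk0 : (0 : ℝ) ≤ k := k.cast_nonneg
  -- the excess `(πq + D₀)/(1 - q)` dominates `D₀`
  have hex : ρ ^ 2 * exp (-M) * (T - s₀) / ϱ ≤ (π * (ε ^ 2 / (M * ϱ ^ 2))
      + ρ ^ 2 * exp (-M) * (T - s₀) / ϱ) / (1 - ε ^ 2 / (M * ϱ ^ 2)) := by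
    rw [le_div_iff₀ h1q]
    nlinarith [mul_nonneg hD0 hq0, mul_nonneg pi_pos.le hq0]
  have hne : M * ϱ ^ 2 - ε ^ 2 ≠ 0 := (sub_pos.2 hq).ne'
  have hup : (π + ρ ^ 2 * exp (-M) * (T - s₀) / ϱ) / (1 - ε ^ 2 / (M * ϱ ^ 2))
      = π + (π * (ε ^ 2 / (M * ϱ ^ 2)) + ρ ^ 2 * exp (-M) * (T - s₀) / ϱ)
        / (1 - ε ^ 2 / (M * ϱ ^ 2)) := by
    field_simp
    ring
  have hη0 : 0 < η := by linarith [swing_lt_pi (X s₀ 1 / X s₀ 2) (X T 1 / X T 2)]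
  have hΦ₀' := abs_le.1 hΦ₀
  have hsplit : (C T - C 0) / ρ ^ 2 - k * π
      = ((C T - C s₀) / ρ ^ 2 - k * π) + (C s₀ - C 0) / ρ ^ 2 := by ring
  rw [hsplit]
  refine abs_le.2 ⟨?_, ?_⟩
  · have h := mul_le_mul_of_nonneg_left hex hk0
    nlinarith [hlo, hΦ₀'.1, h, mul_nonneg hk0 hD0]
  · rw [mul_div_assoc, hup] at hhi
    nlinarith [hhi, hΦ₀'.2, mul_nonneg hk0 hη0.le]

end Summit.NavierStokesRegularity.FluidComputer.GateBudget
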